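import Mathlib
import Summits.NavierStokesRegularity.OSWSelfSimilar.SheetNSLineTorusCascadeModes
import HarnessLib

/-!
# Viscous CLM on the torus (`a = 0`, `σ = 2`): the universal head modes `E_1, E_2, E_3` IN CLOSED FORM and their WINDOW LOWER
# BOUNDS — the kernel ingredients of a datum-free head/tail certificate

HONEST FRAMING (cell ns-blowup GROUP B «PROFILE SEARCH», zone Z3, row Z3-U addendum A-F2 of `HOME/profile/z3/CENSUS-Z3.md`;
human rulings D-0035/D-0074; Z3-TWIN lineage): **1-D MODEL (viscous Constantin–Lax–Majda equation `ω_t = ω Hω + ν ω_xx` on `𝕋`);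
exact ODE algebra on the Fourier cascade, kernel-checked; not Euler, not Navier–Stokes; «violates: none — MODEL».**

OBJECT: the universal family `E = cascadeSolution 1 (sineDatum 1)` (`ν = c = 1`) of `SheetNSLineTorusCascadeExistence` / `…Scaling`
(every `(ν, c)` sine cascade is `ν (c/ν)^k E_k(νt)`). Writing `x = e^{−t}`:
* `univ_one`, `univ_two`, `univ_three` — `E_1 = x`, `E_2 = (x² − x⁴)/4`, **`E_3 = x³/24 − x⁵/16 + x⁹/48`** (mode 3 by the scalar
  linear-ODE uniqueness `E_3′ = E_1E_2 − 9E_3`, `E_3(0) = 0`; `hasDerivAt_univ_three`);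
* WINDOW LOWER BOUNDS on a time interval where `v_b ≤ e^{−s} ≤ v_a ≤ 1` (`0 ≤ v_b`): `univ_one_ge` (`E_1 ≥ v_b`), `univ_two_ge`
  (`E_2 ≥ v_b²(1 − v_a²)/4`), `univ_three_ge` (`E_3 ≥ v_b³·(1/24 − v_a²/16 + v_a⁶/48)`; the bracket `g₃(u) = (1−u)²(u+2)/48` is
  antitone on `[0,1]`, `g3_antitone`) — each mode is `x^j g_j(x²)` with `g_j` antitone, so on a window the minimum is bounded by
  (far endpoint)^j × g_j(near endpoint²);
* `exp_neg_le_of_neg_log_le`, `le_exp_neg_of_le_neg_log` — the dictionary `s ≥ −log v ⇔ e^{−s} ≤ v` used to place `s` in a window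
  with rational endpoints `v`.
READING: these are the head ingredients for `SheetNSLineTorusCascadeKernelThirtyOne` (a DATUM-FREE instance of the static head/tail
certificate `unbounded_of_universal_static_base`, p516509, with `k₀ = 3`: blow-up at `t = log 2/ν` for every `c ≥ 31ν`, improving the
kernel's `48ν`). bears_on: LADDER-NS N5 / zone Z3 (row Z3-U) → N1 linear core. WHAT THIS IS NOT: not NS; no PDE object; no definitions;
no number outside the kernel.
-/

namespace Summit.NavierStokesRegularity.OSWSelfSimilar
namespace SheetNSLineTorusCascade

open Finset Real Set

/-! ### A scalar linear-ODE uniqueness lemma -/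

/-- Two solutions of `y′ = φ − μ y` on `ℝ` with the same value at `0` coincide (`e^{μt}(f − g)` has zero derivative). [folklore] -/
private theorem eq_of_forced_linear {f g φ : ℝ → ℝ} {μ : ℝ}
    (hf : ∀ t, HasDerivAt f (φ t - μ * f t) t) (hg : ∀ t, HasDerivAt g (φ t - μ * g t) t) (h0 : f 0 = g 0) :
    ∀ t, f t = g t := by
  have hw : ∀ t, HasDerivAt (fun s => exp (μ * s) * (f s - g s)) 0 t := by
    intro t
    have h1 : HasDerivAt (fun s => exp (μ * s)) (exp (μ * t) * μ) t := by
      have := ((hasDerivAt_id t).const_mul μ).exp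
      simpa using this
    refine (h1.mul ((hf t).sub (hg t))).congr_deriv ?_
    simp only [Pi.sub_apply]
    ring
  have hdiff : Differentiable ℝ (fun s => exp (μ * s) * (f s - g s)) := fun t => (hw t).differentiableAt
  intro t
  have hconst := is_const_of_deriv_eq_zero hdiff (fun s => (hw s).deriv) t 0
  simp only [mul_zero, exp_zero, h0, sub_self, mul_eq_zero, exp_ne_zero, false_or, sub_eq_zero] at hconst
  exact hconst

/-! ### Closed forms of the universal head modes -/

/-- `E_1(t) = e^{−t}`. [new here — MODEL] -/
theorem univ_one (t : ℝ) : cascadeSolution 1 (sineDatum 1) 1 t = exp (-t) := by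
  rw [cascadeSolution_sine_one]; simp

/-- `E_2(t) = (x² − x⁴)/4`, `x = e^{−t}`. [new here — MODEL] -/
theorem univ_two (t : ℝ) : cascadeSolution 1 (sineDatum 1) 2 t = (exp (-t) ^ 2 - exp (-t) ^ 4) / 4 := by
  rw [cascadeSolution_sine_two one_ne_zero]
  have h2 : exp (-(2 * 1 * t)) = exp (-t) ^ 2 := by rw [← Real.exp_nat_mul]; congr 1; ring
  have h4 : exp (-(4 * 1 * t)) = exp (-t) ^ 4 := by rw [← Real.exp_nat_mul]; congr 1; ring
  rw [h2, h4]
  ring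

/-- **The ODE of the universal mode 3:** `E_3′ = E_1 E_2 − 9 E_3` on `ℝ` (the antidiagonal of `3` contributes `E_1E_2 + E_2E_1`, mode
`0` vanishing). [new here — MODEL] -/
theorem hasDerivAt_univ_three (t : ℝ) :
    HasDerivAt (cascadeSolution 1 (sineDatum 1) 3)
      (cascadeSolution 1 (sineDatum 1) 1 t * cascadeSolution 1 (sineDatum 1) 2 t
        - 9 * cascadeSolution 1 (sineDatum 1) 3 t) t := by
  have h := hasDerivAt_cascadeSolution (ν := 1) (sineDatum_zero 1) 3 t
  refine h.congr_deriv ?_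
  rw [Finset.Nat.sum_antidiagonal_eq_sum_range_succ_mk]
  simp [sum_range_succ]
  ring

/-- **`E_3(t) = x³/24 − x⁵/16 + x⁹/48`, `x = e^{−t}`** (both sides solve `y′ = E_1E_2 − 9y`, `y(0) = 0`). [new here — MODEL] -/
theorem univ_three (t : ℝ) :
    cascadeSolution 1 (sineDatum 1) 3 t = exp (-t) ^ 3 / 24 - exp (-t) ^ 5 / 16 + exp (-t) ^ 9 / 48 := by
  have hx : ∀ s : ℝ, HasDerivAt (fun s => exp (-s)) (-exp (-s)) s := fun s => by
    simpa using (hasDerivAt_neg s).exp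
  have hFd : ∀ s : ℝ, HasDerivAt (fun s => exp (-s) ^ 3 / 24 - exp (-s) ^ 5 / 16 + exp (-s) ^ 9 / 48)
      (cascadeSolution 1 (sineDatum 1) 1 s * cascadeSolution 1 (sineDatum 1) 2 s
        - 9 * (exp (-s) ^ 3 / 24 - exp (-s) ^ 5 / 16 + exp (-s) ^ 9 / 48)) s := by
    intro s
    have h3 : HasDerivAt (fun s => exp (-s) ^ 3) (3 * exp (-s) ^ 2 * (-exp (-s))) s := by
      simpa using (hx s).fun_pow 3
    have h5 : HasDerivAt (fun s => exp (-s) ^ 5) (5 * exp (-s) ^ 4 * (-exp (-s))) s := by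
      simpa using (hx s).fun_pow 5
    have h9 : HasDerivAt (fun s => exp (-s) ^ 9) (9 * exp (-s) ^ 8 * (-exp (-s))) s := by
      simpa using (hx s).fun_pow 9
    refine (((h3.div_const 24).sub (h5.div_const 16)).add (h9.div_const 48)).congr_deriv ?_
    rw [univ_one, univ_two]
    ring
  refine eq_of_forced_linear (φ := fun s => cascadeSolution 1 (sineDatum 1) 1 s * cascadeSolution 1 (sineDatum 1) 2 s)
    (μ := 9) (fun s => hasDerivAt_univ_three s) (fun s => hFd s) ?_ t
  rw [cascadeSolution_init]
  simp [sineDatum]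
  norm_num

/-! ### Window lower bounds (`v_b ≤ e^{−s} ≤ v_a ≤ 1`) -/

/-- `s ≥ −log v` ⇒ `e^{−s} ≤ v` (`v > 0`). [folklore] -/
theorem exp_neg_le_of_neg_log_le {s v : ℝ} (hv : 0 < v) (h : -Real.log v ≤ s) : exp (-s) ≤ v := by
  calc exp (-s) ≤ exp (Real.log v) := exp_le_exp.mpr (by linarith)
    _ = v := exp_log hv

/-- `s ≤ −log v` ⇒ `v ≤ e^{−s}` (`v > 0`). [folklore] -/
theorem le_exp_neg_of_le_neg_log {s v : ℝ} (hv : 0 < v) (h : s ≤ -Real.log v) : v ≤ exp (-s) := by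
  calc v = exp (Real.log v) := (exp_log hv).symm
    _ ≤ exp (-s) := exp_le_exp.mpr (by linarith)

/-- **Mode 1 on a window:** `v_b ≤ e^{−s}` ⇒ `v_b ≤ E_1(s)`. [new here — MODEL] -/
theorem univ_one_ge {s vb : ℝ} (hb : vb ≤ exp (-s)) : vb ≤ cascadeSolution 1 (sineDatum 1) 1 s := by
  rw [univ_one]; exact hb

/-- **Mode 2 on a window:** `0 ≤ v_b ≤ e^{−s} ≤ v_a ≤ 1` ⇒ `v_b²(1 − v_a²)/4 ≤ E_2(s)` (`E_2 = x²(1 − x²)/4`, product of a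
non-decreasing and a non-increasing nonnegative factor of `x`). [new here — MODEL] -/
theorem univ_two_ge {s va vb : ℝ} (hvb : 0 ≤ vb) (hb : vb ≤ exp (-s)) (ha : exp (-s) ≤ va) (hva : va ≤ 1) :
    vb ^ 2 * (1 - va ^ 2) / 4 ≤ cascadeSolution 1 (sineDatum 1) 2 s := by
  rw [univ_two]
  have hx0 : 0 ≤ exp (-s) := (exp_pos _).le
  have hva0 : 0 ≤ va := le_trans hx0 ha
  have h1 : vb ^ 2 ≤ exp (-s) ^ 2 := pow_le_pow_left₀ hvb hb 2
  have h2 : exp (-s) ^ 2 ≤ va ^ 2 := pow_le_pow_left₀ hx0 ha 2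
  have h3 : va ^ 2 ≤ 1 := by nlinarith
  have h4 : 0 ≤ 1 - va ^ 2 := by linarith
  calc vb ^ 2 * (1 - va ^ 2) / 4 ≤ exp (-s) ^ 2 * (1 - exp (-s) ^ 2) / 4 := by gcongr
    _ = (exp (-s) ^ 2 - exp (-s) ^ 4) / 4 := by ring

/-- The bracket `g₃(u) = 1/24 − u/16 + u³/48 = (1−u)²(u+2)/48` is antitone on `[0,1]`. [folklore] -/
theorem g3_antitone {u₁ u₂ : ℝ} (h0 : 0 ≤ u₁) (h12 : u₁ ≤ u₂) (h1 : u₂ ≤ 1) :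
    1 / 24 - u₂ / 16 + u₂ ^ 3 / 48 ≤ 1 / 24 - u₁ / 16 + u₁ ^ 3 / 48 := by
  have hid : (1 / 24 - u₁ / 16 + u₁ ^ 3 / 48) - (1 / 24 - u₂ / 16 + u₂ ^ 3 / 48)
      = (u₂ - u₁) * (3 - u₁ ^ 2 - u₁ * u₂ - u₂ ^ 2) / 48 := by ring
  have hu1 : u₁ ≤ 1 := le_trans h12 h1
  have hu2 : 0 ≤ u₂ := le_trans h0 h12
  have hA : 0 ≤ 3 - u₁ ^ 2 - u₁ * u₂ - u₂ ^ 2 := by nlinarith [mul_le_mul h12 h1 hu2 (by linarith : (0:ℝ) ≤ u₂)]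
  have hB : 0 ≤ (u₂ - u₁) * (3 - u₁ ^ 2 - u₁ * u₂ - u₂ ^ 2) / 48 :=
    div_nonneg (mul_nonneg (sub_nonneg.mpr h12) hA) (by norm_num)
  linarith

/-- `g₃ ≥ 0` on `[0,1]` (`g₃(1) = 0`). -/
theorem g3_nonneg {u : ℝ} (h0 : 0 ≤ u) (h1 : u ≤ 1) : 0 ≤ 1 / 24 - u / 16 + u ^ 3 / 48 := by
  have := g3_antitone h0 h1 le_rfl
  norm_num at this
  linarith

/-- **Mode 3 on a window:** `0 ≤ v_b ≤ e^{−s} ≤ v_a ≤ 1` ⇒ `v_b³·(1/24 − v_a²/16 + (v_a²)³/48) ≤ E_3(s)`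
(`E_3 = x³ g₃(x²)` with `g₃` antitone and nonnegative on `[0,1]`). [new here — MODEL] -/
theorem univ_three_ge {s va vb : ℝ} (hvb : 0 ≤ vb) (hb : vb ≤ exp (-s)) (ha : exp (-s) ≤ va) (hva : va ≤ 1) :
    vb ^ 3 * (1 / 24 - va ^ 2 / 16 + (va ^ 2) ^ 3 / 48) ≤ cascadeSolution 1 (sineDatum 1) 3 s := by
  rw [univ_three]
  have hx0 : 0 ≤ exp (-s) := (exp_pos _).le
  have hva0 : 0 ≤ va := le_trans hx0 ha
  have h1 : vb ^ 3 ≤ exp (-s) ^ 3 := pow_le_pow_left₀ hvb hb 3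
  have h2 : exp (-s) ^ 2 ≤ va ^ 2 := pow_le_pow_left₀ hx0 ha 2
  have h3 : va ^ 2 ≤ 1 := by nlinarith
  have hg : 1 / 24 - va ^ 2 / 16 + (va ^ 2) ^ 3 / 48 ≤ 1 / 24 - exp (-s) ^ 2 / 16 + (exp (-s) ^ 2) ^ 3 / 48 :=
    g3_antitone (by positivity) h2 h3
  have hg0 : 0 ≤ 1 / 24 - va ^ 2 / 16 + (va ^ 2) ^ 3 / 48 := g3_nonneg (by positivity) h3
  calc vb ^ 3 * (1 / 24 - va ^ 2 / 16 + (va ^ 2) ^ 3 / 48)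
      ≤ exp (-s) ^ 3 * (1 / 24 - exp (-s) ^ 2 / 16 + (exp (-s) ^ 2) ^ 3 / 48) :=
        mul_le_mul h1 hg hg0 (by positivity)
    _ = exp (-s) ^ 3 / 24 - exp (-s) ^ 5 / 16 + exp (-s) ^ 9 / 48 := by ring

/-! ### Appended (v2): mode 4 — closed form, antitone bracket, window bound -/

/-- **The ODE of the universal mode 4:** `E_4′ = E_1 E_3 + E_2²/2 − 16 E_4` on `ℝ`. [new here — MODEL] -/
theorem hasDerivAt_univ_four (t : ℝ) :
    HasDerivAt (cascadeSolution 1 (sineDatum 1) 4)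
      (cascadeSolution 1 (sineDatum 1) 1 t * cascadeSolution 1 (sineDatum 1) 3 t
        + cascadeSolution 1 (sineDatum 1) 2 t ^ 2 / 2 - 16 * cascadeSolution 1 (sineDatum 1) 4 t) t := by
  have h := hasDerivAt_cascadeSolution (ν := 1) (sineDatum_zero 1) 4 t
  refine h.congr_deriv ?_
  rw [Finset.Nat.sum_antidiagonal_eq_sum_range_succ_mk]
  simp [sum_range_succ]
  ring

/-- **`E_4(t) = 7x⁴/1152 − x⁶/80 + x⁸/256 + x¹⁰/288 − 11x¹⁶/11520`, `x = e^{−t}`** (both sides solve `y′ = E_1E_3 + E_2²/2 − 16y`,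
`y(0) = 0`). [new here — MODEL] -/
theorem univ_four (t : ℝ) :
    cascadeSolution 1 (sineDatum 1) 4 t
      = 7 * exp (-t) ^ 4 / 1152 - exp (-t) ^ 6 / 80 + exp (-t) ^ 8 / 256 + exp (-t) ^ 10 / 288
        - 11 * exp (-t) ^ 16 / 11520 := by
  have hx : ∀ s : ℝ, HasDerivAt (fun s => exp (-s)) (-exp (-s)) s := fun s => by
    simpa using (hasDerivAt_neg s).exp
  have hFd : ∀ s : ℝ, HasDerivAt
      (fun s => 7 * exp (-s) ^ 4 / 1152 - exp (-s) ^ 6 / 80 + exp (-s) ^ 8 / 256 + exp (-s) ^ 10 / 288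
        - 11 * exp (-s) ^ 16 / 11520)
      (cascadeSolution 1 (sineDatum 1) 1 s * cascadeSolution 1 (sineDatum 1) 3 s
        + cascadeSolution 1 (sineDatum 1) 2 s ^ 2 / 2
        - 16 * (7 * exp (-s) ^ 4 / 1152 - exp (-s) ^ 6 / 80 + exp (-s) ^ 8 / 256 + exp (-s) ^ 10 / 288
          - 11 * exp (-s) ^ 16 / 11520)) s := by
    intro s
    have h4 : HasDerivAt (fun s => exp (-s) ^ 4) (4 * exp (-s) ^ 3 * (-exp (-s))) s := by
      simpa using (hx s).fun_pow 4
    have h6 : HasDerivAt (fun s => exp (-s) ^ 6) (6 * exp (-s) ^ 5 * (-exp (-s))) s := by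
      simpa using (hx s).fun_pow 6
    have h8 : HasDerivAt (fun s => exp (-s) ^ 8) (8 * exp (-s) ^ 7 * (-exp (-s))) s := by
      simpa using (hx s).fun_pow 8
    have h10 : HasDerivAt (fun s => exp (-s) ^ 10) (10 * exp (-s) ^ 9 * (-exp (-s))) s := by
      simpa using (hx s).fun_pow 10
    have h16 : HasDerivAt (fun s => exp (-s) ^ 16) (16 * exp (-s) ^ 15 * (-exp (-s))) s := by
      simpa using (hx s).fun_pow 16
    refine ((((((h4.const_mul 7).div_const 1152).sub (h6.div_const 80)).add (h8.div_const 256)).add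
      (h10.div_const 288)).sub ((h16.const_mul 11).div_const 11520)).congr_deriv ?_
    rw [univ_one, univ_two, univ_three]
    ring
  refine eq_of_forced_linear
    (φ := fun s => cascadeSolution 1 (sineDatum 1) 1 s * cascadeSolution 1 (sineDatum 1) 3 s
      + cascadeSolution 1 (sineDatum 1) 2 s ^ 2 / 2)
    (μ := 16) (fun s => hasDerivAt_univ_four s) (fun s => hFd s) ?_ t
  rw [cascadeSolution_init]
  simp [sineDatum]
  norm_num

/-- The bracket `g₄(u) = 7/1152 − u/80 + u²/256 + u³/288 − 11u⁶/11520` (`E_4 = x⁴ g₄(x²)`) is antitone on `[0,1]`: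
`g₄′(u) = −(1−u)²(24 + 33u + 22u² + 11u³)/1920 ≤ 0`. [folklore] -/
theorem g4_antitone {u₁ u₂ : ℝ} (h0 : 0 ≤ u₁) (h12 : u₁ ≤ u₂) (h1 : u₂ ≤ 1) :
    7 / 1152 - u₂ / 80 + u₂ ^ 2 / 256 + u₂ ^ 3 / 288 - 11 * u₂ ^ 6 / 11520
      ≤ 7 / 1152 - u₁ / 80 + u₁ ^ 2 / 256 + u₁ ^ 3 / 288 - 11 * u₁ ^ 6 / 11520 := by
  have hd : ∀ u : ℝ, HasDerivAt (fun u : ℝ => 7 / 1152 - u / 80 + u ^ 2 / 256 + u ^ 3 / 288 - 11 * u ^ 6 / 11520)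
      (-((1 - u) ^ 2 * (24 + 33 * u + 22 * u ^ 2 + 11 * u ^ 3) / 1920)) u := by
    intro u
    have h1 : HasDerivAt (fun u : ℝ => u) 1 u := hasDerivAt_id u
    have h2 : HasDerivAt (fun u : ℝ => u ^ 2) (2 * u) u := by simpa using hasDerivAt_pow 2 u
    have h3 : HasDerivAt (fun u : ℝ => u ^ 3) (3 * u ^ 2) u := by simpa using hasDerivAt_pow 3 u
    have h6 : HasDerivAt (fun u : ℝ => u ^ 6) (6 * u ^ 5) u := by simpa using hasDerivAt_pow 6 u
    refine (((((hasDerivAt_const u (7 / 1152 : ℝ)).sub (h1.div_const 80)).add (h2.div_const 256)).add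
      (h3.div_const 288)).sub ((h6.const_mul 11).div_const 11520)).congr_deriv ?_
    ring
  have hanti : AntitoneOn (fun u : ℝ => 7 / 1152 - u / 80 + u ^ 2 / 256 + u ^ 3 / 288 - 11 * u ^ 6 / 11520)
      (Icc 0 1) := by
    refine antitoneOn_of_deriv_nonpos (convex_Icc 0 1) (fun u _ => (hd u).continuousAt.continuousWithinAt)
      (fun u _ => (hd u).differentiableAt.differentiableWithinAt) fun u hu => ?_
    rw [interior_Icc] at hu
    rw [(hd u).deriv]
    have hu0 : 0 ≤ u := hu.1.le
    have hsq : 0 ≤ (1 - u) ^ 2 := sq_nonneg _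
    have hcub : 0 ≤ 24 + 33 * u + 22 * u ^ 2 + 11 * u ^ 3 := by
      have h2 : 0 ≤ u ^ 2 := pow_nonneg hu0 2
      have h3 : 0 ≤ u ^ 3 := pow_nonneg hu0 3
      linarith
    have : 0 ≤ (1 - u) ^ 2 * (24 + 33 * u + 22 * u ^ 2 + 11 * u ^ 3) / 1920 :=
      div_nonneg (mul_nonneg hsq hcub) (by norm_num)
    linarith
  exact hanti ⟨h0, le_trans h12 h1⟩ ⟨le_trans h0 h12, h1⟩ h12

/-- `g₄ ≥ 0` on `[0,1]` (`g₄(1) = 0`). -/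
theorem g4_nonneg {u : ℝ} (h0 : 0 ≤ u) (h1 : u ≤ 1) :
    0 ≤ 7 / 1152 - u / 80 + u ^ 2 / 256 + u ^ 3 / 288 - 11 * u ^ 6 / 11520 := by
  have := g4_antitone h0 h1 le_rfl
  norm_num at this
  linarith

/-- **Mode 4 on a window:** `0 ≤ v_b ≤ e^{−s} ≤ v_a ≤ 1` ⇒ `v_b⁴·g₄(v_a²) ≤ E_4(s)` (`E_4 = x⁴ g₄(x²)`, `g₄` antitone and nonnegative
on `[0,1]`). [new here — MODEL] -/
theorem univ_four_ge {s va vb : ℝ} (hvb : 0 ≤ vb) (hb : vb ≤ exp (-s)) (ha : exp (-s) ≤ va) (hva : va ≤ 1) :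
    vb ^ 4 * (7 / 1152 - va ^ 2 / 80 + (va ^ 2) ^ 2 / 256 + (va ^ 2) ^ 3 / 288 - 11 * (va ^ 2) ^ 6 / 11520)
      ≤ cascadeSolution 1 (sineDatum 1) 4 s := by
  rw [univ_four]
  have hx0 : 0 ≤ exp (-s) := (exp_pos _).le
  have hva0 : 0 ≤ va := le_trans hx0 ha
  have h1 : vb ^ 4 ≤ exp (-s) ^ 4 := pow_le_pow_left₀ hvb hb 4
  have h2 : exp (-s) ^ 2 ≤ va ^ 2 := pow_le_pow_left₀ hx0 ha 2
  have h3 : va ^ 2 ≤ 1 := by nlinarith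
  have hg : 7 / 1152 - va ^ 2 / 80 + (va ^ 2) ^ 2 / 256 + (va ^ 2) ^ 3 / 288 - 11 * (va ^ 2) ^ 6 / 11520
      ≤ 7 / 1152 - exp (-s) ^ 2 / 80 + (exp (-s) ^ 2) ^ 2 / 256 + (exp (-s) ^ 2) ^ 3 / 288
        - 11 * (exp (-s) ^ 2) ^ 6 / 11520 :=
    g4_antitone (by positivity) h2 h3
  have hg0 : 0 ≤ 7 / 1152 - va ^ 2 / 80 + (va ^ 2) ^ 2 / 256 + (va ^ 2) ^ 3 / 288 - 11 * (va ^ 2) ^ 6 / 11520 :=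
    g4_nonneg (by positivity) h3
  calc vb ^ 4 * (7 / 1152 - va ^ 2 / 80 + (va ^ 2) ^ 2 / 256 + (va ^ 2) ^ 3 / 288 - 11 * (va ^ 2) ^ 6 / 11520)
      ≤ exp (-s) ^ 4 * (7 / 1152 - exp (-s) ^ 2 / 80 + (exp (-s) ^ 2) ^ 2 / 256 + (exp (-s) ^ 2) ^ 3 / 288
          - 11 * (exp (-s) ^ 2) ^ 6 / 11520) :=
        mul_le_mul h1 hg hg0 (by positivity)
    _ = 7 * exp (-s) ^ 4 / 1152 - exp (-s) ^ 6 / 80 + exp (-s) ^ 8 / 256 + exp (-s) ^ 10 / 288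
        - 11 * exp (-s) ^ 16 / 11520 := by ring

end SheetNSLineTorusCascade
end Summit.NavierStokesRegularity.OSWSelfSimilar
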